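import Summits.BirchSwinnertonDyer.Rank1Residual.GaloisImage.PrimeToPDescentH1
import Summits.BirchSwinnertonDyer.Rank1Residual.X2.GreenbergVatsalSelmerLink
import HarnessLib

/-!
# The 'Greenberg ⊆ Kummer' local inclusion at `v ∣ p` DESCENDS along an extension of degree prime
# to `p`: `N.greenbergKer H ≤ localKerOver H  ⟹  N.greenbergKer H' ≤ localKerOver H'` for
# `H = H' ⊓ U`, `p ∤ [H' : H]` (cell `b2b-bsdres`, team n1011, row T-RD-Δ-K = kernel half of r2's
# ROUTE-2 §II.15.3 ARM δ; lead R5-40 (b); seat n1011-p05 gen 3)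

HONEST FRAMING (cell `b2b-bsdres`, run/shared/lean/b2b/bsd-rank1-residual/, verbatim in every
file): the goal of the cell is to DELETE the COMBINATION-SHAPED residual classes of the
Birch–Swinnerton-Dyer formula for ALL analytic-rank `≤ 1` elliptic curves over `ℚ` — "full BSD
formula for every rank `≤ 1` curve in class `C`" assembled STRICTLY from published theorems — so
that the rank-`≤ 1` remainder becomes exactly the CONSTRUCTION-SHAPED classes, which are TYPED
(missing-input `Prop`s), NOT attempted. This is not "finishing BSD". Team n1011 (X4 ∧ `p = 3`,
§I N10/N11; ROUTE-2 of planner r2): research route; TOOL theorems of Galois cohomology; no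
definition, no named fact; the Greenberg-1999-Prop.-2.4 statement over the tame field is cc-typer-2's
FACT (p262636) and appears here ONLY as the hypothesis `hK`; nothing booked; no label changes.

## What and why

ROUTE-2 §II.15.3 (ARM δ, CLAIM δ1): at a TAME potentially-ordinary additive prime `p` of `E/ℚ`, over
the tame field `F ⊂ ℚ(μ_p)` (`[F : ℚ] = e ∣ p − 1`) the curve is good ordinary, so Greenberg's
Prop. 2.4 (LNM 1716, pp. 73–75) gives `Im κ = Im(H¹(·, C) → H¹(·, E[p^∞]))` over `F_∞ = F·ℚ_∞`;
"then the DESCENT is pure Galois cohomology … `#Δ_w = e` prime to `p`".  In the tree's model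
(`SubgroupSelmer`, `GreenbergSelmer`; `H¹` of the subgroup `H ≤ Γ_K` pulled back from `L = K̄^H`,
local conditions `W.localKerOver p H K_v` = "restricts into `Im κ` at the chosen place above `v`"
and `N.greenbergKer H` = Greenberg's condition for the datum `N` (`M⁺_v = C`), exactly the currency
of the tree's fact `GreenbergVatsal2000.imKummer_ge_greenbergCondition_at_p`) the descent reads:

* `resOfLe_mem_greenbergKer` — Greenberg's condition is functorial under restriction `H ≤ H'`;
* **`greenbergKer_le_localKerOver_of_coprime_descent`** — for `E = W` elliptic over a number field
  `K`, a prime `p`, a place `v`, a Greenberg datum `N` at `v`, a CLOSED normal `H' ≤ Γ_K` and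
  `H = H' ⊓ U` with `U` OPEN normal and `p ∤ [H' : H]`:
  **`N.greenbergKer H ≤ W.localKerOver p H K_v → N.greenbergKer H' ≤ W.localKerOver p H' K_v`**
  (restrict, apply the hypothesis, come back with additive-p1's
  `relIndex_nsmul_mem_localKerOver_of_resOfLe_mem_rel` — `[H' : H] • x` is Kummer —, and divide
  by `[H' : H]` in the `p`-primary `H¹(H', E[p^∞])`, `PrimeToPDescentH1.mem_ker_of_nsmul_mem_ker_of_coprime`);
* `greenbergKer_eq_localKerOver_of_coprime_descent` — EQUALITY `Im κ = Im λ` at the level `H'`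
  from the inclusion at level `H` plus the datum's Kummer property (tree converse
  `GreenbergVatsalSelmerLink.localKerOver_le_greenbergKer`, X2 lineage, by name);
* `greenbergKer_le_localKerOver_kerSubgroup_of_coprime_descent` — the instance `H' = ker κ`
  (`L' = K_∞` for a `ℤ_p`-extension `κ`, e.g. the cyclotomic one) and `U` open normal of index prime
  to `p` (e.g. `U = Gal(K̄/F)`, `F ⊂ ℚ(μ_p)`): the 'Greenberg ⊆ Kummer' inclusion over `F·K_∞` — the
  TYPED fact `hK` — gives it over `K_∞`, in the shape of `imKummer_ge_greenbergCondition_at_p`;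
  `…_kerSubgroup_of_index_coprime` — the same from `U` open normal with `p ∤ [Γ_K : U]` only;
* §3 STRICT currency (decomposition group `H ⊓ D_v`, Greenberg's printed `Im λ`; the tree's
  `LocalDatum.strictKer`, the currency of cc-typer-2's typed Prop. 2.4
  `Greenberg1999.imKummer_ge_strictCondition_goodOrdinary`): `resOfLe_mem_strictKer`,
  **`strictKer_le_localKerOver_of_coprime_descent`**, `strictKer_le_localKerOver_kerSubgroup_of_index_coprime`
  (consumes that fact's `….kerSubgroup_inf` conclusion literally), and
  `greenbergKer_le_localKerOver_of_strict_coprime_descent` (back to the inertia currency at the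
  bottom level given `N.greenbergKer H' ≤ N.strictKer H'` there).

The converse inclusion `localKerOver ≤ greenbergKer` is the tree theorem
`GreenbergVatsalSelmerLink.localKerOver_le_greenbergKer` at every level; the GLOBAL Selmer descent
is additive-p1's `PrimeToPDescent.selmerRelRestriction_bijective_of_coprime`; the ramified ordinary
line `C` of the additive rows is p10's / p07's `IsRamifiedOrdinaryLine` object — none re-proved here.

References: [GreenbergLNM1716] §2 Props. 2.2, 2.4 (pp. 73–75), §5 p. 143; [GreenbergVatsal2000] §2
p. 26; [SerreGaloisCohomology1997] I.§2.4.
-/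

noncomputable section

open scoped Classical

namespace Summit.BirchSwinnertonDyer.Rank1Residual.Additive.TameDescent

open Literature.NumberTheory.EllipticCurves Literature.NumberTheory.EllipticCurves.GreenbergSelmer
  Literature.NumberTheory.GaloisRepresentations WeierstrassCurve
  Summit.BirchSwinnertonDyer.Rank1Residual.AdditivePotMult
  Summit.BirchSwinnertonDyer.Rank1Residual.GaloisImage

variable {K : Type} [Field K] [NumberField K] (W : WeierstrassCurve K) (p : ℕ)
variable {v : IsDedekindDomain.HeightOneSpectrum (NumberField.RingOfIntegers K)}
variable (N : LocalDatum K (W.geomPrimaryTorsion p) v)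
variable {H H' U : Subgroup (Field.absoluteGaloisGroup K)}

/-! ## §1 Greenberg's condition is functorial under restriction -/

/-- `H ≤ H' ⟹ H ⊓ I_v ≤ H' ⊓ I_v` inside `D_v`. [folklore] -/
theorem inertiaIn_mono (h : H ≤ H') : inertiaIn H v ≤ inertiaIn H' v := fun y hy ↦
  (mem_inertiaIn_iff H' v y).2 ⟨h ((mem_inertiaIn_iff H v y).1 hy).1, ((mem_inertiaIn_iff H v y).1 hy).2⟩

/-- **Greenberg's local condition is functorial**: if `x ∈ H¹(H', E[p^∞])` dies in
`H¹(H' ⊓ I_v, E[p^∞]/M⁺_v)` then `res_{H' → H} x` dies in `H¹(H ⊓ I_v, E[p^∞]/M⁺_v)`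
(`res ∘ res = res`). [cite: Greenberg1989, §1 p. 98 (4)] -/
theorem resOfLe_mem_greenbergKer (h : H ≤ H') {x : W.subgroupH1 p H'} (hx : x ∈ N.greenbergKer H') :
    W.resOfLe p h x ∈ N.greenbergKer H := by
  have key : (N.greenbergMap H).comp (W.resOfLe p h) =
      (resH1Hom (subgroupInclusion (inertiaIn_mono (v := v) h)) (AddMonoidHom.id N.Gr)
        (fun _ _ ↦ rfl)).comp (N.greenbergMap H') := by
    rw [LocalDatum.greenbergMap, LocalDatum.greenbergMap, WeierstrassCurve.resOfLe,
      Literature.NumberTheory.EllipticCurves.resOfLe, resH1Hom_comp, resH1Hom_comp]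
    exact resH1Hom_congr (by ext; rfl) (by ext; rfl) _ _
  rw [LocalDatum.mem_greenbergKer_iff] at hx ⊢
  have h1 := congrArg (fun f => f x) key
  simp only [AddMonoidHom.comp_apply] at h1
  rw [h1, hx, map_zero]

/-! ## §2 The descent -/

variable [Fact p.Prime] [H.Normal] [H'.Normal]

omit [Fact p.Prime] [H'.Normal] in
/-- **The 'Greenberg ⊆ Kummer' inclusion descends along a prime-to-`p` step.** For `E = W` elliptic
over a number field `K`, a prime `p`, a place `v`, a Greenberg datum `N` at `v` (`M⁺_v ≤ E[p^∞]`
stable under `D_v`), a CLOSED normal subgroup `H' ≤ Γ_K` (`L' = K̄^{H'}`, e.g. `K_∞`) and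
`H = H' ⊓ U` with `U` OPEN normal (`L = L'·K̄^U`) and `p ∤ [H' : H] = [L : L']`: if every class of
`H¹(L, E[p^∞])` satisfying Greenberg's condition at the place above `v` is locally Kummer there, the
same holds over `L'`. (Restrict to `H`, apply the hypothesis, return with
`[H' : H] •` (additive-p1 `relIndex_nsmul_mem_localKerOver_of_resOfLe_mem_rel`), and divide by
`[H' : H]` in the `p`-primary `H¹(H', E[p^∞])`.) This is r2's "Δ-descent of `Im κ_{K_{∞,w'}} =
Im λ_{K_{∞,w'}}` to `ℚ_{∞,w}`" in the currency of the tree's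
`GreenbergVatsal2000.imKummer_ge_greenbergCondition_at_p`. [cite: GreenbergLNM1716, §2 Props. 2.2, 2.4 (pp. 73–75) and §5 p. 143] -/
theorem greenbergKer_le_localKerOver_of_coprime_descent (h : H ≤ H')
    (hU : IsOpen (U : Set (Field.absoluteGaloisGroup K))) (hHU : H = H' ⊓ U)
    [(H.subgroupOf H').FiniteIndex] (hH' : IsClosed (H' : Set (Field.absoluteGaloisGroup K)))
    (hcop : (H.relIndex H').Coprime p)
    (hK : N.greenbergKer H ≤ W.localKerOver p H (v.adicCompletion K)) :
    N.greenbergKer H' ≤ W.localKerOver p H' (v.adicCompletion K) := by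
  intro x hx
  have h1 : W.resOfLe p h x ∈ N.greenbergKer H := resOfLe_mem_greenbergKer W p N h hx
  have h2 : H.relIndex H' • x ∈ W.localKerOver p H' (v.adicCompletion K) :=
    relIndex_nsmul_mem_localKerOver_of_resOfLe_mem_rel W p h hU hHU (hK h1)
  rw [WeierstrassCurve.localKerOver] at h2 ⊢
  exact mem_ker_of_nsmul_mem_ker_of_coprime _
    (exists_pow_nsmul_eq_zero_subgroupH1_of_isClosed W p hH') hcop h2

/-- **The instance `L' = K_∞`** (`H' = ker κ` for a `ℤ_p`-extension `κ` of `K`, closed normal) and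
`L = F·K_∞` for a finite Galois `F/K` with `p ∤ [Γ_K : Gal(K̄/F)]` (`U` open normal; e.g.
`F ⊂ ℚ(μ_p)` of degree `e ∣ p − 1` over `K = ℚ` — r2's tame field): the 'Greenberg ⊆ Kummer'
inclusion over `F·K_∞` (the TYPED Greenberg Prop. 2.4 input `hK`, cc-typer-2's fact once filed)
gives it over `K_∞`. [cite: GreenbergLNM1716, §2 Prop. 2.4 (pp. 74–75) and §5 p. 143] -/
theorem greenbergKer_le_localKerOver_kerSubgroup_of_coprime_descent
    (κ : ZpExtension K p) [U.Normal] (hU : IsOpen (U : Set (Field.absoluteGaloisGroup K)))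
    [((κ.kerSubgroup ⊓ U).subgroupOf κ.kerSubgroup).FiniteIndex]
    (hcop : ((κ.kerSubgroup ⊓ U).relIndex κ.kerSubgroup).Coprime p)
    (hK : N.greenbergKer (κ.kerSubgroup ⊓ U) ≤
      W.localKerOver p (κ.kerSubgroup ⊓ U) (v.adicCompletion K)) :
    N.greenbergKer κ.kerSubgroup ≤ W.localKerOver p κ.kerSubgroup (v.adicCompletion K) :=
  greenbergKer_le_localKerOver_of_coprime_descent W p N inf_le_left hU rfl
    κ.isClosed_kerSubgroup hcop hK

omit [Fact p.Prime] [H'.Normal] in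
/-- **EQUALITY form: `Im κ = Im λ` descends.** With the datum's Kummer property `hN` (inertia-moved
local points land in `M⁺_v` — the content of Greenberg's Prop. 2.2, supplied by the datum's owner),
the tree's `GreenbergVatsalSelmerLink.localKerOver_le_greenbergKer` gives `localKerOver ≤ greenbergKer`
at EVERY level, so the descended inclusion is an equality:
`N.greenbergKer H' = W.localKerOver p H' K_v`. [cite: GreenbergLNM1716, §2 Props. 2.2, 2.4 (pp. 73–75)] -/
theorem greenbergKer_eq_localKerOver_of_coprime_descent (h : H ≤ H')
    (hU : IsOpen (U : Set (Field.absoluteGaloisGroup K))) (hHU : H = H' ⊓ U)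
    [(H.subgroupOf H').FiniteIndex] (hH' : IsClosed (H' : Set (Field.absoluteGaloisGroup K)))
    (hcop : (H.relIndex H').Coprime p)
    (hN : ∀ σ ∈ absInertia (v.adicCompletion K), ∀ (P : localPoints W (v.adicCompletion K))
      (m : W.geomPrimaryTorsion p),
      pointsMap W (v.adicCompletion K) (m : W.geomPoints) = σ • P - P → m ∈ N.plus)
    (hK : N.greenbergKer H ≤ W.localKerOver p H (v.adicCompletion K)) :
    N.greenbergKer H' = W.localKerOver p H' (v.adicCompletion K) :=
  le_antisymm (greenbergKer_le_localKerOver_of_coprime_descent W p N h hU hHU hH' hcop hK)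
    (X2.GreenbergVatsalSelmerLink.localKerOver_le_greenbergKer W p H' N hN)

/-- **The cyclotomic/tame instance with the minimal hypotheses** (as in additive-p1's
`selmerInfty_relRestriction_bijective`): `K_∞ = K̄^{ker κ}` for a `ℤ_p`-extension `κ`, `U ≤ Γ_K` OPEN
normal with `p ∤ [Γ_K : U]` (`F = K̄^U`; e.g. `K = ℚ`, `F ⊂ ℚ(μ_p)` the tame field of an additive
potentially-ordinary prime): the 'Greenberg ⊆ Kummer' inclusion over `F·K_∞` — the typed Greenberg
Prop. 2.4 input `hK` — gives it over `K_∞`. [cite: GreenbergLNM1716, §2 Prop. 2.4 (pp. 74–75) and §5 p. 143] -/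
theorem greenbergKer_le_localKerOver_kerSubgroup_of_index_coprime
    (κ : ZpExtension K p) [U.Normal] (hU : IsOpen (U : Set (Field.absoluteGaloisGroup K)))
    (hcop : U.index.Coprime p)
    (hK : N.greenbergKer (κ.kerSubgroup ⊓ U) ≤
      W.localKerOver p (κ.kerSubgroup ⊓ U) (v.adicCompletion K)) :
    N.greenbergKer κ.kerSubgroup ≤ W.localKerOver p κ.kerSubgroup (v.adicCompletion K) := by
  haveI : CompactSpace (Field.absoluteGaloisGroup K) := compactSpace_absoluteGaloisGroup K
  haveI : DiscreteTopology (Field.absoluteGaloisGroup K ⧸ U) := QuotientGroup.discreteTopology hU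
  haveI : Finite (Field.absoluteGaloisGroup K ⧸ U) := finite_of_compact_of_discrete
  haveI : U.FiniteIndex := Subgroup.finiteIndex_of_finite_quotient
  haveI : ((κ.kerSubgroup ⊓ U).subgroupOf κ.kerSubgroup).FiniteIndex := by
    rw [Subgroup.inf_subgroupOf_left]; infer_instance
  have hrel : (κ.kerSubgroup ⊓ U).relIndex κ.kerSubgroup ∣ U.index := by
    rw [Subgroup.inf_relIndex_left]
    exact Subgroup.relIndex_dvd_index_of_normal U κ.kerSubgroup
  exact greenbergKer_le_localKerOver_kerSubgroup_of_coprime_descent W p N κ hU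
    (Nat.Coprime.coprime_dvd_left hrel hcop) hK

/-! ## §3 The same descent in Greenberg's STRICT currency (decomposition group at `v`)

Greenberg LNM 1716 Prop. 2.4 is printed with the decomposition group: `Im λ_K =
ker (H¹(K, E[p^∞]) → H¹(K, Ẽ[p^∞]))`, the tree's `LocalDatum.strictKer` (cc-typer-2's typed fact
`Greenberg1999.imKummer_ge_strictCondition_goodOrdinary`, conclusion
`N.strictKer H ≤ W.localKerOver p H K_v`); the descent is verbatim the same. -/

omit [Fact p.Prime] [H.Normal] [H'.Normal] in
/-- `H ≤ H' ⟹ H ⊓ D_v ≤ H' ⊓ D_v` inside `D_v`. [folklore] -/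
theorem decompIn_mono (h : H ≤ H') : decompIn H v ≤ decompIn H' v := fun y hy ↦
  (mem_decompIn_iff H' v y).2 (h ((mem_decompIn_iff H v y).1 hy))

omit [Fact p.Prime] [H.Normal] [H'.Normal] in
/-- **The strict local condition is functorial**: if `x ∈ H¹(H', E[p^∞])` dies in
`H¹(H' ⊓ D_v, E[p^∞]/M⁺_v)` then `res_{H' → H} x` dies in `H¹(H ⊓ D_v, E[p^∞]/M⁺_v)`.
[cite: Greenberg1989, §1 p. 98] -/
theorem resOfLe_mem_strictKer (h : H ≤ H') {x : W.subgroupH1 p H'} (hx : x ∈ N.strictKer H') :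
    W.resOfLe p h x ∈ N.strictKer H := by
  have key : (N.strictMap H).comp (W.resOfLe p h) =
      (resH1Hom (subgroupInclusion (decompIn_mono (v := v) h)) (AddMonoidHom.id N.Gr)
        (fun _ _ ↦ rfl)).comp (N.strictMap H') := by
    rw [LocalDatum.strictMap, LocalDatum.strictMap, WeierstrassCurve.resOfLe,
      Literature.NumberTheory.EllipticCurves.resOfLe, resH1Hom_comp, resH1Hom_comp]
    exact resH1Hom_congr (by ext; rfl) (by ext; rfl) _ _
  rw [LocalDatum.mem_strictKer_iff] at hx ⊢
  have h1 := congrArg (fun f => f x) key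
  simp only [AddMonoidHom.comp_apply] at h1
  rw [h1, hx, map_zero]

omit [Fact p.Prime] [H'.Normal] in
/-- **The STRICT 'Greenberg ⊆ Kummer' inclusion descends along a prime-to-`p` step**: as
`greenbergKer_le_localKerOver_of_coprime_descent` with `strictKer` (decomposition group) for
`greenbergKer` (inertia group) — the currency in which Greenberg's Prop. 2.4 is printed and typed.
[cite: GreenbergLNM1716, §2 Prop. 2.4 (pp. 74–75) and §5 p. 143] -/
theorem strictKer_le_localKerOver_of_coprime_descent (h : H ≤ H')
    (hU : IsOpen (U : Set (Field.absoluteGaloisGroup K))) (hHU : H = H' ⊓ U)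
    [(H.subgroupOf H').FiniteIndex] (hH' : IsClosed (H' : Set (Field.absoluteGaloisGroup K)))
    (hcop : (H.relIndex H').Coprime p)
    (hK : N.strictKer H ≤ W.localKerOver p H (v.adicCompletion K)) :
    N.strictKer H' ≤ W.localKerOver p H' (v.adicCompletion K) := by
  intro x hx
  have h1 : W.resOfLe p h x ∈ N.strictKer H := resOfLe_mem_strictKer W p N h hx
  have h2 : H.relIndex H' • x ∈ W.localKerOver p H' (v.adicCompletion K) :=
    relIndex_nsmul_mem_localKerOver_of_resOfLe_mem_rel W p h hU hHU (hK h1)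
  rw [WeierstrassCurve.localKerOver] at h2 ⊢
  exact mem_ker_of_nsmul_mem_ker_of_coprime _
    (exists_pow_nsmul_eq_zero_subgroupH1_of_isClosed W p hH') hcop h2

/-- **The cyclotomic/tame instance, strict currency, minimal hypotheses**: `U ≤ Γ_K` OPEN normal with
`p ∤ [Γ_K : U]`, `κ` a `ℤ_p`-extension; the strict inclusion over `K̄^U·K_∞` — literally the
conclusion of cc-typer-2's `imKummer_ge_strictCondition_goodOrdinary.kerSubgroup_inf` — gives it over
`K_∞`. [cite: GreenbergLNM1716, §2 Prop. 2.4 (pp. 74–75) and §5 p. 143] -/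
theorem strictKer_le_localKerOver_kerSubgroup_of_index_coprime
    (κ : ZpExtension K p) [U.Normal] (hU : IsOpen (U : Set (Field.absoluteGaloisGroup K)))
    (hcop : U.index.Coprime p)
    (hK : N.strictKer (κ.kerSubgroup ⊓ U) ≤
      W.localKerOver p (κ.kerSubgroup ⊓ U) (v.adicCompletion K)) :
    N.strictKer κ.kerSubgroup ≤ W.localKerOver p κ.kerSubgroup (v.adicCompletion K) := by
  haveI : CompactSpace (Field.absoluteGaloisGroup K) := compactSpace_absoluteGaloisGroup K
  haveI : DiscreteTopology (Field.absoluteGaloisGroup K ⧸ U) := QuotientGroup.discreteTopology hU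
  haveI : Finite (Field.absoluteGaloisGroup K ⧸ U) := finite_of_compact_of_discrete
  haveI : U.FiniteIndex := Subgroup.finiteIndex_of_finite_quotient
  haveI : ((κ.kerSubgroup ⊓ U).subgroupOf κ.kerSubgroup).FiniteIndex := by
    rw [Subgroup.inf_subgroupOf_left]; infer_instance
  have hrel : (κ.kerSubgroup ⊓ U).relIndex κ.kerSubgroup ∣ U.index := by
    rw [Subgroup.inf_relIndex_left]
    exact Subgroup.relIndex_dvd_index_of_normal U κ.kerSubgroup
  exact strictKer_le_localKerOver_of_coprime_descent W p N inf_le_left hU rfl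
    κ.isClosed_kerSubgroup (Nat.Coprime.coprime_dvd_left hrel hcop) hK

omit [Fact p.Prime] [H'.Normal] in
/-- **Back to Greenberg's (inertia) currency at the bottom level.** If over `L' = K̄^{H'}` Greenberg's
condition is already as strong as the strict one (`N.greenbergKer H' ≤ N.strictKer H'` — e.g. when
`(E[p^∞]/M⁺_v)` has no non-zero `H' ⊓ I_v`-invariants, inflation–restriction), the descended strict
inclusion yields the 'Greenberg ⊆ Kummer' inclusion `N.greenbergKer H' ≤ W.localKerOver p H' K_v`.
[cite: GreenbergLNM1716, §2 Props. 2.2, 2.4 (pp. 73–75)] -/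
theorem greenbergKer_le_localKerOver_of_strict_coprime_descent (h : H ≤ H')
    (hU : IsOpen (U : Set (Field.absoluteGaloisGroup K))) (hHU : H = H' ⊓ U)
    [(H.subgroupOf H').FiniteIndex] (hH' : IsClosed (H' : Set (Field.absoluteGaloisGroup K)))
    (hcop : (H.relIndex H').Coprime p) (hGS : N.greenbergKer H' ≤ N.strictKer H')
    (hK : N.strictKer H ≤ W.localKerOver p H (v.adicCompletion K)) :
    N.greenbergKer H' ≤ W.localKerOver p H' (v.adicCompletion K) :=
  hGS.trans (strictKer_le_localKerOver_of_coprime_descent W p N h hU hHU hH' hcop hK)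

end Summit.BirchSwinnertonDyer.Rank1Residual.Additive.TameDescent

end
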